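import Mathlib.Analysis.InnerProductSpace.Rayleigh
import Mathlib.Algebra.BigOperators.Fin
import HarnessLib

/-!
# K2R `RealisedQuasiStaticCellLaw`, line `floquet-bloch`, stub `stub_lowSectorDecay` (S1D): near-commuting products

Summits-side helper (everything proved; no definitions, no named facts; `--supports stmt-AnomalousDissipation-20446`).
Brick (F3) of the S1D stub plan (cell `ad-ideate`, planner ad-p1 gen 15, `STUB-PLAN-stub_lowSectorDecay.md` §4.3):
the NEAR-sector period composition. Over one period the slow `2`-plane sees the ordered product of the slot (or
same-direction pair) factors `1 − B_j`, each `B_j` a small symmetric operator; isotropy of the word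
(`isotropicWordGain_cubatureWord`) controls only the SUM `Σ_j B_j ≈ X_real·1`, so one needs

  `‖Π_j (1 − B_j)‖ ≤ 1 − λ_min(Σ_j B_j) + (Σ_j ‖B_j‖)²`,

i.e. the factors commute to second order. Two elementary facts, stated in any real inner product space `E`:

* `norm_listProd_one_sub_sub_le` (any normed ring): if `Σ_j ‖B_j‖ ≤ 1` then
  `‖Π_j(1 − B_j) − (1 − Σ_j B_j)‖ ≤ (Σ_j ‖B_j‖)²` (induction on the list: the new cross terms of `(1 − B)·P` are
  `B·ΣB' − B·Rem`, and `bN + (1 + b)N² ≤ (N + b)²` for `N ≤ 1`); no positivity or symmetry is used here;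
* `norm_one_sub_le_of_inner_ge` : for a SYMMETRIC `T` with `m‖x‖² ≤ ⟪Tx, x⟫` and `‖T‖ ≤ 1`, `m ≤ 1`:
  `‖1 − T‖ ≤ 1 − m` (the norm of a symmetric operator is the supremum of its Rayleigh quotient,
  `ContinuousLinearMap.norm_eq_iSup_rayleighQuotient`);
* `norm_prod_one_sub_le` (the brick, `Fin n`-indexed ordered product): symmetric `B_j` with `Σ‖B_j‖ ≤ X ≤ 1` and
  `m‖x‖² ≤ ⟪(Σ_j B_j)x, x⟫`, `m ≤ 1` ⟹ `‖Π_j(1 − B_j)‖ ≤ 1 − m + X²`.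

Positive semi-definiteness of the individual `B_j` (as in the plan) is not needed. Deliberately NOT here: the
identification of the slot propagators on the slow plane with `e^{−d₀T_j}(1 − B_j) + F_j` (column/Riccati lemma §4.1)
and the isotropy computation of `Σ_j B_j` — those are the S1D closer's.
-/

set_option linter.dupNamespace false -- layout D-0017: `AnomalousDissipation.AnomalousDissipation` repeats by design

namespace Summit.AnomalousDissipation.AnomalousDissipation.Theorems.SolenoidalFractalHomogenisation.RealisedQuasiStaticCellLaw

noncomputable section

open scoped InnerProductSpace BigOperators

/-! ## Second-order commutation of a product of near-identity factors (any normed ring) -/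

/-- Triangle inequality for list sums (recorded here to keep the file self-contained). -/
theorem norm_listSum_le {A : Type*} [SeminormedAddCommGroup A] (l : List A) :
    ‖l.sum‖ ≤ (l.map fun B => ‖B‖).sum := by
  induction l with
  | nil => simp
  | cons B l ih =>
    rw [List.sum_cons, List.map_cons, List.sum_cons]
    exact (norm_add_le _ _).trans (add_le_add le_rfl ih)

/-- **Product expansion to second order.** In a normed ring, if `Σ_j ‖B_j‖ ≤ 1` then the ordered product of the
`1 − B_j` differs from `1 − Σ_j B_j` by at most `(Σ_j ‖B_j‖)²` in norm. -/
theorem norm_listProd_one_sub_sub_le {A : Type*} [NormedRing A] (l : List A)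
    (hl : (l.map fun B => ‖B‖).sum ≤ 1) :
    ‖(l.map fun B => 1 - B).prod - (1 - l.sum)‖ ≤ (l.map fun B => ‖B‖).sum ^ 2 := by
  induction l with
  | nil => simp
  | cons B l ih =>
    rw [List.map_cons, List.sum_cons] at hl
    have hN0 : 0 ≤ (l.map fun B => ‖B‖).sum :=
      List.sum_nonneg (by
        intro x hx
        obtain ⟨y, -, rfl⟩ := List.mem_map.1 hx
        exact norm_nonneg y)
    have hb0 : 0 ≤ ‖B‖ := norm_nonneg B
    have hN1 : (l.map fun B => ‖B‖).sum ≤ 1 := by linarith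
    have ih' := ih hN1
    set P := (l.map fun B => 1 - B).prod with hP
    set N := (l.map fun B => ‖B‖).sum with hN
    set R := P - (1 - l.sum) with hR
    rw [List.map_cons, List.prod_cons, List.map_cons, List.sum_cons, List.sum_cons, ← hP]
    have hPe : P = (1 - l.sum) + R := by rw [hR]; abel
    have key : (1 - B) * P - (1 - (B + l.sum)) = R + B * l.sum - B * R := by
      rw [hPe]; noncomm_ring
    rw [key]
    have h1 : ‖R + B * l.sum - B * R‖ ≤ ‖R‖ + ‖B‖ * ‖l.sum‖ + ‖B‖ * ‖R‖ := by
      refine (norm_sub_le _ _).trans (add_le_add ((norm_add_le _ _).trans (add_le_add le_rfl ?_)) ?_)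
      · exact norm_mul_le _ _
      · exact norm_mul_le _ _
    have h2 : ‖l.sum‖ ≤ N := norm_listSum_le l
    have h3 : ‖R‖ ≤ N ^ 2 := ih'
    have h4 : ‖B‖ * ‖l.sum‖ ≤ ‖B‖ * N := mul_le_mul_of_nonneg_left h2 hb0
    have h5 : ‖B‖ * ‖R‖ ≤ ‖B‖ * N ^ 2 := mul_le_mul_of_nonneg_left h3 hb0
    have h6 : ‖B‖ * N ^ 2 ≤ ‖B‖ * N := by
      refine mul_le_mul_of_nonneg_left ?_ hb0
      nlinarith
    nlinarith

/-! ## Symmetric operators: the norm of `1 − T` from a lower Rayleigh bound -/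

variable {E : Type*} [NormedAddCommGroup E] [InnerProductSpace ℝ E]

/-- **`‖1 − T‖ ≤ 1 − m` for symmetric `T` with `m ≤ T ≤ 1` in the quadratic-form sense.** Precisely: if `T` is
symmetric, `m‖x‖² ≤ ⟪Tx, x⟫` and `⟪Tx, x⟫ ≤ ‖x‖²` for all `x`, and `m ≤ 1`, then `‖1 − T‖ ≤ 1 − m` (operator norm).
Proof: `1 − T` is symmetric with Rayleigh quotient in `[0, 1 − m]`, and the norm of a symmetric operator is the
supremum of the absolute Rayleigh quotient (`ContinuousLinearMap.norm_eq_iSup_rayleighQuotient`). -/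
theorem norm_one_sub_le_of_inner_ge (T : E →L[ℝ] E) (m : ℝ) (hT : (T : E →ₗ[ℝ] E).IsSymmetric)
    (hm : ∀ x : E, m * ‖x‖ ^ 2 ≤ ⟪T x, x⟫_ℝ) (hT1 : ∀ x : E, ⟪T x, x⟫_ℝ ≤ ‖x‖ ^ 2) (hm1 : m ≤ 1) :
    ‖(1 : E →L[ℝ] E) - T‖ ≤ 1 - m := by
  have hsymm : ((1 - T : E →L[ℝ] E) : E →ₗ[ℝ] E).IsSymmetric := by
    intro x y
    simp only [ContinuousLinearMap.toLinearMap_sub, ContinuousLinearMap.toLinearMap_one, LinearMap.sub_apply,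
      Module.End.one_apply, inner_sub_left, inner_sub_right]
    rw [hT x y]
  rw [ContinuousLinearMap.norm_eq_iSup_rayleighQuotient _ hsymm]
  haveI : Nonempty E := ⟨0⟩
  refine ciSup_le fun x => ?_
  rw [ContinuousLinearMap.rayleighQuotient, ContinuousLinearMap.reApplyInnerSelf_apply]
  simp only [sub_apply, one_apply_eq_self, inner_sub_left,
    real_inner_self_eq_norm_sq, RCLike.re_to_real]
  by_cases hx : x = 0
  · subst hx
    simp only [norm_zero, ne_eq, OfNat.ofNat_ne_zero, not_false_eq_true, zero_pow, map_zero,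
      inner_zero_left, sub_self, div_zero, abs_zero]
    linarith
  have hx2 : 0 < ‖x‖ ^ 2 := by positivity
  rw [abs_div, abs_of_pos hx2, div_le_iff₀ hx2]
  have h1 := hm x
  have h2 := hT1 x
  rw [abs_le]
  constructor <;> nlinarith

/-! ## The brick: near-commuting product of symmetric near-identity factors -/

/-- **Near-commuting product estimate (S1D §4.3).** Let `B₀, …, B_{n−1}` be symmetric bounded operators on a real
inner product space with `Σ_j ‖B_j‖ ≤ X ≤ 1`, and let `m ≤ 1` be a lower bound of the quadratic form of their sum,
`m‖x‖² ≤ ⟪(Σ_j B_j)x, x⟫`. Then the ORDERED product satisfies `‖Π_j (1 − B_j)‖ ≤ 1 − m + X²`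
(`= ‖1 − Σ_j B_j‖ +` second-order commutation remainder). -/
theorem norm_prod_one_sub_le {n : ℕ} (B : Fin n → (E →L[ℝ] E)) (X m : ℝ)
    (hsymm : ∀ j, (B j : E →ₗ[ℝ] E).IsSymmetric)
    (hX : ∑ j, ‖B j‖ ≤ X) (hX1 : X ≤ 1) (hm1 : m ≤ 1)
    (hm : ∀ x : E, m * ‖x‖ ^ 2 ≤ ⟪(∑ j, B j) x, x⟫_ℝ) :
    ‖(List.ofFn fun j => (1 : E →L[ℝ] E) - B j).prod‖ ≤ 1 - m + X ^ 2 := by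
  set l : List (E →L[ℝ] E) := List.ofFn B with hl
  have hmap : (List.ofFn fun j => (1 : E →L[ℝ] E) - B j) = l.map fun B => 1 - B := by
    rw [hl, List.map_ofFn]; rfl
  have hsum : l.sum = ∑ j, B j := by rw [hl, List.sum_ofFn]
  have hnorm : (l.map fun B => ‖B‖).sum = ∑ j, ‖B j‖ := by
    rw [hl, List.map_ofFn, List.sum_ofFn]; rfl
  have hN0 : 0 ≤ ∑ j, ‖B j‖ := Finset.sum_nonneg fun j _ => norm_nonneg _
  have hN1 : (l.map fun B => ‖B‖).sum ≤ 1 := by rw [hnorm]; linarith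
  have hrem := norm_listProd_one_sub_sub_le l hN1
  rw [hnorm, hsum] at hrem
  -- the symmetric main term
  have hTsymm : ((∑ j, B j : E →L[ℝ] E) : E →ₗ[ℝ] E).IsSymmetric := by
    rw [ContinuousLinearMap.toLinearMap_sum]
    exact LinearMap.isSymmetric_sum _ fun j _ => hsymm j
  have hT1 : ∀ x : E, ⟪(∑ j, B j) x, x⟫_ℝ ≤ ‖x‖ ^ 2 := by
    intro x
    calc ⟪(∑ j, B j) x, x⟫_ℝ ≤ ‖(∑ j, B j) x‖ * ‖x‖ := real_inner_le_norm _ _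
      _ ≤ (‖∑ j, B j‖ * ‖x‖) * ‖x‖ :=
          mul_le_mul_of_nonneg_right (ContinuousLinearMap.le_opNorm _ _) (norm_nonneg _)
      _ ≤ (1 * ‖x‖) * ‖x‖ := by
          refine mul_le_mul_of_nonneg_right (mul_le_mul_of_nonneg_right ?_ (norm_nonneg _)) (norm_nonneg _)
          exact (norm_sum_le _ _).trans (hX.trans hX1)
      _ = ‖x‖ ^ 2 := by ring
  have hmain := norm_one_sub_le_of_inner_ge (∑ j, B j) m hTsymm hm hT1 hm1
  -- assemble
  rw [hmap]
  have hsq : (∑ j, ‖B j‖) ^ 2 ≤ X ^ 2 := pow_le_pow_left₀ hN0 hX 2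
  calc ‖(l.map fun B => 1 - B).prod‖
      = ‖((1 : E →L[ℝ] E) - ∑ j, B j) + ((l.map fun B => 1 - B).prod - (1 - ∑ j, B j))‖ := by
        congr 1; abel
    _ ≤ ‖(1 : E →L[ℝ] E) - ∑ j, B j‖ + ‖(l.map fun B => 1 - B).prod - (1 - ∑ j, B j)‖ := norm_add_le _ _
    _ ≤ (1 - m) + (∑ j, ‖B j‖) ^ 2 := add_le_add hmain hrem
    _ ≤ 1 - m + X ^ 2 := by linarith

end

end Summit.AnomalousDissipation.AnomalousDissipation.Theorems.SolenoidalFractalHomogenisation.RealisedQuasiStaticCellLaw
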